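import Literature.Probability.LatticeModels.IsoradialGraphs
import Literature.Probability.LatticeModels.IsoradialGraphsProofs
import HarnessLib

/-!
# The square-grid property SGP(I) of Grimmett–Manolescu, as printed

`Literature.Probability.LatticeModels.RhombicEmbedding.HasSquareGridProperty` (file
`IsoradialGraphs`) is an "H21 rendering" of the square-grid property whose docstring asks for a
clause-by-clause re-check against the paper. This file records the outcome of that check:
the printed definition (Grimmett–Manolescu, PTRF 159 (2014), §4.2 = arXiv:1204.0505 §4.2) is
**strictly stronger** than the H21 rendering, and we vendor it faithfully under new names.

The printed definition. Let `I ∈ ℕ`. An isoradial graph `G` has the property **SGP(I)** if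
its track-set `𝒯` may be *partitioned* as `𝒯 = S ∪ T₁ ∪ T₂` such that:
* (a) for `k = 1, 2`, `T_k = (t_k^i : i ∈ ℤ)` is a family of distinct non-intersecting tracks
  indexed by `ℤ`;
* (b) for `k = 1, 2` and **every** track `s ∈ 𝒯 ∖ T_k`, every track of `T_k` intersects `s`,
  and these intersections occur (along `s`) in the order of their indices;
* (c) for `k = 1, 2`, `i ∈ ℤ` and `s ∈ T_{3-k}`, the number of track-intersections on `s`
  between its intersections with `t_k^i` and `t_k^{i+1}` is strictly less than `I`.
`G` has the *square-grid property* (SGP) if it satisfies SGP(I) for some `I`; `T₁ ∪ T₂` is then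
a *square grid* of `G`. (The main theorems of the paper are stated for the class `𝒢(ε, I)` of
graphs with BAP(ε) and SGP(I), with constants depending on `ε` **and `I`**.)

What the H21 rendering `HasSquareGridProperty` keeps: (a) (as simple tracks), the mutual
crossing of the two grid families, a separation bound `∃ M` in place of (c), and a weak
"betweenness" substitute for (b) (a track meeting `s_i` and `s_k` meets every `s_j`,
`i < j < k`). What it drops: in (b), that *every other track of the graph* crosses *all* tracks
of *both* grid families, and the *order* of these crossings. The two are not equivalent, even
for rhombic tilings with bounded angles: tile the plane by unit squares and insert one extra
track `R` of rhombi (sides `(1,0)` or `(0,1)` and `w = (cos β, sin β)`, `β ∈ (π/2, π)`) along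
the boundary of the region `{y ≤ 0} ∪ {0 ≤ y ≤ ⌊x⌋}` — a horizontal row of sheared rhombi for
`x ≤ 0` continued by a north-east staircase. Then `R` crosses every column track but only the
row tracks of index `≥ 0`, so `R` can lie neither in `S` (it misses some rows; those rows would
then also lie in `S` and have to cross both families, forcing both families into the columns,
which do not cross each other) nor in a family `T_k` indexed *in order* by `ℤ` (the other
members of `T_k` would be rows of negative index, and along a column `R` comes after all of
them, so `R` would need an extreme index): this tiling — whose tracks are the columns, the rows
and `R` — has **no** square grid in the printed sense, while (columns, rows) satisfies every
clause of `HasSquareGridProperty` with `M = 1`. Consequently statements assuming only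
`HasSquareGridProperty` (e.g. the transcriptions of GM's Thm 1.1–1.2 in
`Literature.Probability.Percolation.Isoradial`) assume *less* than the source and should be read
with `HasSquareGridPropertyGM` / `SquareGridPropertyGM I` instead.

Contents.
* `IsReparametrization r t`: the sequence `r : ℤ → α` is a shift, or a reversed shift, of `t` —
  the identification under which a track "is" a member of a family (`s ∈ T_k`); tracks being
  doubly-infinite sequences of rhombi defined from an unoriented starting side, this is exactly
  the ambiguity in GM's construction (§4.2).
* `CrossesInOrder r t`: `r` meets `t i` exactly at the index `φ i` of `r`, with `φ` strictly
  monotone or strictly antitone ((b), second half; see its docstring for "exactly").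
* `RhombicEmbedding.IsSquareGridGM s t I`: `(s, t)` is a square grid satisfying (a)–(c) with
  parameter `I`; `RhombicEmbedding.SquareGridPropertyGM I` = SGP(I);
  `RhombicEmbedding.HasSquareGridPropertyGM` = SGP.
* `IsSquareGridGM.hasSquareGridProperty`, `HasSquareGridPropertyGM.hasSquareGridProperty`: the
  printed property implies the H21 rendering (so every fact assuming the latter applies).
* `isSquareGridGM_squareLattice`: the antidiagonal and diagonal tracks of `ℤ²` form a square
  grid with `I = 1` (GM §4.3.1: "the track-system of an isoradial square lattice is simply a
  square grid"), via the classification of the tracks of `ℤ²`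
  (`isTrack_squareLattice_classification`); hence `squareGridPropertyGM_squareLattice`,
  `hasSquareGridPropertyGM_squareLattice`; and `isReparametrization_of_isTrack_squareLattice`:
  the track-system of `ℤ²` consists of these two families only (`S = ∅`, GM §4.3.1, §4.6).

Rendering notes (all within GM's setting of rhombic tilings, §4.2: "the rhombi in a track are
distinct", "two distinct tracks may have no more than one rhombus in common", "each rhombus
belongs to exactly two tracks"):
* grid tracks are taken *simple* (`IsSimpleTrack`, as in the H21 rendering) — automatic for
  rhombic tilings; the "other" tracks in (b) range over all `IsTrack r`;
* in (b), a track `s ∉ T_k` and `t_k^i` are distinct tracks, so they share at most one rhombus,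
  visited once by `s`: the meeting index is unique, whence `meetIndices s (t_k^i) = {φ i}`;
* in (c), every rhombus of `s` is the intersection of `s` with exactly one other track, and `s`
  is simple, so "the number of track-intersections on `s` strictly between its intersections
  with `t_k^i` and `t_k^{i+1}`" is the number of indices of `s` strictly between the two meeting
  indices, `(trackBetween s (t_k^i) (t_k^{i+1})).encard` (the same set as in the H21 rendering);
* no planarity is assumed by these predicates themselves (as everywhere in `IsoradialGraphs`);
  they are meant to be used together with `IsIsoradial` / `IsRhombicTiling`.

References: G. R. Grimmett, I. Manolescu, *Bond percolation on isoradial graphs: criticality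
and universality*, PTRF 159 (2014) 273–327, §4.2 (track systems, SGP(I)), §4.3.1 and §4.6
(isoradial square lattices), §3 (main results for `𝒢(ε, I)`); J.-H. Li, *Universality of the
random-cluster model and applications to quantum systems*, thesis, Geneva 2017, Def. 2.1
(same reading of (b): "all tracks of `𝒯(G) ∖ {s_n}` intersect all those of `(s_n)`").
-/

namespace Literature.Probability.LatticeModels

/-! ### Reparametrisations and ordered crossings of tracks -/

section Tracks

variable {α : Type*} {V : Type*} {G : SimpleGraph V}

/-- `r` is a *reparametrisation* of the doubly-infinite sequence `t`: a shift `r n = t (n + c)`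
or a reversed shift `r n = t (c - n)`. For train tracks (doubly-infinite sequences of rhombi
built from a starting side, Grimmett–Manolescu 2014, §4.2) this is exactly the ambiguity of the
construction (choice of starting side along the track, and of direction), i.e. the relation
"`r` and `t` are the same element of the track-set `𝒯(G)`". [cite: GrimmettManolescu2014, §4.2] -/
def IsReparametrization (r t : ℤ → α) : Prop :=
  ∃ c : ℤ, (∀ n, r n = t (n + c)) ∨ (∀ n, r n = t (c - n))

/-- Every sequence is a reparametrisation of itself (shift `0`). [folklore] -/
theorem IsReparametrization.refl (t : ℤ → α) : IsReparametrization t t :=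
  ⟨0, Or.inl fun n => by rw [add_zero]⟩

/-- A reparametrisation of `t` takes only values of `t`. [folklore] -/
theorem IsReparametrization.exists_eq {r t : ℤ → α} (h : IsReparametrization r t) (m : ℤ) :
    ∃ n, r m = t n := by
  obtain ⟨c, h | h⟩ := h
  · exact ⟨m + c, h m⟩
  · exact ⟨c - m, h m⟩

/-- A reparametrisation has the same set of values (for tracks: the same set of rhombi). [folklore] -/
theorem IsReparametrization.range_eq {r t : ℤ → α} (h : IsReparametrization r t) :
    Set.range r = Set.range t := by
  obtain ⟨c, h | h⟩ := h
  · ext x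
    constructor
    · rintro ⟨m, rfl⟩
      exact ⟨m + c, (h m).symm⟩
    · rintro ⟨n, rfl⟩
      exact ⟨n - c, by rw [h, sub_add_cancel]⟩
  · ext x
    constructor
    · rintro ⟨m, rfl⟩
      exact ⟨c - m, (h m).symm⟩
    · rintro ⟨n, rfl⟩
      exact ⟨c - n, by rw [h, sub_sub_cancel]⟩

/-- If a reparametrisation of `t` meets `u`, then `t` meets `u`.
(Grimmett–Manolescu 2014, §4.2: intersection is a property of tracks as sets of rhombi.) [cite: GrimmettManolescu2014, §4.2] -/
theorem IsReparametrization.trackMeets {r t u : ℤ → G.edgeSet} (h : IsReparametrization r t)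
    (hru : trackMeets r u) : trackMeets t u := by
  obtain ⟨m, n, hmn⟩ := hru
  obtain ⟨m', hm'⟩ := h.exists_eq m
  exact ⟨m', n, hm'.symm.trans hmn⟩

/-- The track `r` *crosses the family `t` in order*: there is a strictly monotone or strictly
antitone `φ : ℤ → ℤ` (the orientation of `r` being arbitrary) such that `r` meets `t i`
exactly at its index `φ i`. This renders the second half of clause (b) of SGP(I), "every track
of `T_k` intersects `s`, and these intersections occur in their lexicographic order"; "exactly"
because distinct tracks of a rhombic tiling share at most one rhombus and the rhombi of a track
are distinct (Grimmett–Manolescu 2014, §4.2), so each intersection is a single index of `s`. [cite: GrimmettManolescu2014, §4.2] -/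
def CrossesInOrder (r : ℤ → G.edgeSet) (t : ℤ → ℤ → G.edgeSet) : Prop :=
  ∃ φ : ℤ → ℤ, (StrictMono φ ∨ StrictAnti φ) ∧ ∀ i, meetIndices r (t i) = {φ i}

/-- A track crossing a family in order meets every member of the family.
(Grimmett–Manolescu 2014, §4.2, clause (b).) [cite: GrimmettManolescu2014, §4.2] -/
theorem CrossesInOrder.trackMeets {r : ℤ → G.edgeSet} {t : ℤ → ℤ → G.edgeSet}
    (h : CrossesInOrder r t) (i : ℤ) : trackMeets r (t i) := by
  obtain ⟨φ, -, hφ⟩ := h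
  rw [trackMeets_iff_nonempty, hφ]
  exact Set.singleton_nonempty _

end Tracks

/-! ### SGP(I) as printed -/

namespace RhombicEmbedding

variable {V : Type*} {G : SimpleGraph V} {F : Type*} (emb : RhombicEmbedding G F)

/-- **A square grid with parameter `I`, as printed** (Grimmett–Manolescu 2014, §4.2). The pair of
`ℤ`-indexed families of tracks `s = T₁`, `t = T₂` satisfies, with `S :=` all remaining tracks:
* (a) `isSimpleTrack_left/right`, `pairwise_not_trackMeets_left/right`: each family consists of
  (simple) tracks, pairwise non-intersecting (hence distinct);
* partition, `not_isReparametrization`: no track of `T₂` is a track of `T₁`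
  (`𝒯 = S ∪ T₁ ∪ T₂` is a partition; `S` is implicit);
* (b) `crossesInOrder_left/right`: every track `r` of the embedding that is not (a
  reparametrisation of) a member of the family crosses *every* member of the family, exactly
  once each, in index order along `r` (`CrossesInOrder`);
* (c) `encard_trackBetween_left/right_lt`: along a track of one family, strictly between its
  meetings with two consecutive tracks `i`, `i + 1` of the other family there are `< I` rhombi
  (= track-intersections on it, each rhombus being its intersection with exactly one other
  track).
See the module docstring for the comparison with the H21 rendering `HasSquareGridProperty`
(which this implies, `IsSquareGridGM.hasSquareGridProperty`, and which is strictly weaker). [cite: GrimmettManolescu2014, §4.2] -/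
structure IsSquareGridGM [DecidableEq V] [DecidableEq F] (s t : ℤ → ℤ → G.edgeSet) (I : ℕ) :
    Prop where
  /-- (a) The tracks of `T₁` are (simple) tracks. -/
  isSimpleTrack_left : ∀ i, emb.IsSimpleTrack (s i)
  /-- (a) The tracks of `T₂` are (simple) tracks. -/
  isSimpleTrack_right : ∀ j, emb.IsSimpleTrack (t j)
  /-- (a) Distinct tracks of `T₁` do not intersect. -/
  pairwise_not_trackMeets_left : Pairwise fun i j => ¬ trackMeets (s i) (s j)
  /-- (a) Distinct tracks of `T₂` do not intersect. -/
  pairwise_not_trackMeets_right : Pairwise fun i j => ¬ trackMeets (t i) (t j)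
  /-- Partition: `T₁ ∩ T₂ = ∅` — no track of `T₂` is (a reparametrisation of) a track of `T₁`. -/
  not_isReparametrization : ∀ i j, ¬ IsReparametrization (t j) (s i)
  /-- (b) Every track outside `T₁` crosses every track of `T₁`, in index order. -/
  crossesInOrder_left : ∀ r : ℤ → G.edgeSet, emb.IsTrack r →
    (∀ i, ¬ IsReparametrization r (s i)) → CrossesInOrder r s
  /-- (b) Every track outside `T₂` crosses every track of `T₂`, in index order. -/
  crossesInOrder_right : ∀ r : ℤ → G.edgeSet, emb.IsTrack r →
    (∀ j, ¬ IsReparametrization r (t j)) → CrossesInOrder r t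
  /-- (c) On `s i`, strictly fewer than `I` rhombi lie strictly between `t j` and `t (j + 1)`. -/
  encard_trackBetween_left_lt : ∀ i j, (trackBetween (s i) (t j) (t (j + 1))).encard < I
  /-- (c) On `t i`, strictly fewer than `I` rhombi lie strictly between `s j` and `s (j + 1)`. -/
  encard_trackBetween_right_lt : ∀ i j, (trackBetween (t i) (s j) (s (j + 1))).encard < I

/-- **SGP(I), as printed**: the embedding possesses a square grid with separation parameter `I`
(Grimmett–Manolescu 2014, §4.2: "`G` has the square grid property SGP(I) if its track-set may
be partitioned into three sets `𝒯 = S ∪ T₁ ∪ T₂` satisfying (a), (b), (c)"). The class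
`𝒢(ε, I)` of the paper is BAP(ε) ∧ SGP(I), and the constants of its Thm 1.1 (box-crossing
property, criticality) depend on both `ε` and `I` (§3). [cite: GrimmettManolescu2014, §4.2] -/
def SquareGridPropertyGM (emb : RhombicEmbedding G F) [DecidableEq V] [DecidableEq F] (I : ℕ) :
    Prop :=
  ∃ s t : ℤ → ℤ → G.edgeSet, emb.IsSquareGridGM s t I

/-- **The square-grid property (SGP), as printed**: SGP(I) holds for some `I ∈ ℕ`
(Grimmett–Manolescu 2014, §4.2: "an isoradial graph is said to have the square grid property
if it satisfies SGP(I) for some `I`"). Strictly stronger than the H21 rendering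
`HasSquareGridProperty` (module docstring; implication `HasSquareGridPropertyGM.hasSquareGridProperty`). [cite: GrimmettManolescu2014, §4.2] -/
def HasSquareGridPropertyGM (emb : RhombicEmbedding G F) [DecidableEq V] [DecidableEq F] : Prop :=
  ∃ I : ℕ, emb.SquareGridPropertyGM I

section

variable {emb} [DecidableEq V] [DecidableEq F] {s t : ℤ → ℤ → G.edgeSet} {I : ℕ}

/-- SGP(I) is monotone in `I`. (Grimmett–Manolescu 2014, §4.2, immediate from clause (c).) [cite: GrimmettManolescu2014, §4.2] -/
theorem IsSquareGridGM.mono {J : ℕ} (h : emb.IsSquareGridGM s t I) (hIJ : I ≤ J) :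
    emb.IsSquareGridGM s t J where
  isSimpleTrack_left := h.isSimpleTrack_left
  isSimpleTrack_right := h.isSimpleTrack_right
  pairwise_not_trackMeets_left := h.pairwise_not_trackMeets_left
  pairwise_not_trackMeets_right := h.pairwise_not_trackMeets_right
  not_isReparametrization := h.not_isReparametrization
  crossesInOrder_left := h.crossesInOrder_left
  crossesInOrder_right := h.crossesInOrder_right
  encard_trackBetween_left_lt i j :=
    lt_of_lt_of_le (h.encard_trackBetween_left_lt i j) (by exact_mod_cast hIJ)
  encard_trackBetween_right_lt i j :=
    lt_of_lt_of_le (h.encard_trackBetween_right_lt i j) (by exact_mod_cast hIJ)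

/-- In a square grid the two families are symmetric: `(t, s)` is a square grid if `(s, t)` is.
(Grimmett–Manolescu 2014, §4.2: the definition is symmetric in `k = 1, 2`.) [cite: GrimmettManolescu2014, §4.2] -/
theorem IsSquareGridGM.symm (h : emb.IsSquareGridGM s t I) : emb.IsSquareGridGM t s I where
  isSimpleTrack_left := h.isSimpleTrack_right
  isSimpleTrack_right := h.isSimpleTrack_left
  pairwise_not_trackMeets_left := h.pairwise_not_trackMeets_right
  pairwise_not_trackMeets_right := h.pairwise_not_trackMeets_left
  not_isReparametrization j i hji := by
    -- here `hji : IsReparametrization (s i) (t j)`; by (b) the track `t (j + 1)` crosses `s i`,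
    -- hence meets `t j`, against (a)
    have hc := h.crossesInOrder_left (t (j + 1)) (h.isSimpleTrack_right (j + 1)).1
      (fun i' => h.not_isReparametrization i' (j + 1))
    obtain ⟨m, n, hmn⟩ := hc.trackMeets i
    refine h.pairwise_not_trackMeets_right (show j + 1 ≠ j by omega) ?_
    obtain ⟨c, hc' | hc'⟩ := hji
    · exact ⟨m, n + c, hmn.trans (hc' n)⟩
    · exact ⟨m, c - n, hmn.trans (hc' n)⟩
  crossesInOrder_left := h.crossesInOrder_right
  crossesInOrder_right := h.crossesInOrder_left
  encard_trackBetween_left_lt := h.encard_trackBetween_right_lt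
  encard_trackBetween_right_lt := h.encard_trackBetween_left_lt

/-- In a square grid every track of `T₁` meets every track of `T₂` (from (b) and the partition
clause). (Grimmett–Manolescu 2014, §4.2.) [cite: GrimmettManolescu2014, §4.2] -/
theorem IsSquareGridGM.meets (h : emb.IsSquareGridGM s t I) (i j : ℤ) :
    trackMeets (s i) (t j) := by
  have hc := h.crossesInOrder_left (t j) (h.isSimpleTrack_right j).1
    (fun i' => h.not_isReparametrization i' j)
  exact (trackMeets_comm _ _).1 (hc.trackMeets i)

/-- A track meeting two distinct tracks of the family `T₁` of a square grid is not a track of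
`T₁`, hence crosses the whole family in order. (Grimmett–Manolescu 2014, §4.2, (a)–(b).) [cite: GrimmettManolescu2014, §4.2] -/
theorem IsSquareGridGM.crossesInOrder_of_trackMeets (h : emb.IsSquareGridGM s t I)
    {r : ℤ → G.edgeSet} (hr : emb.IsTrack r) {i k : ℤ} (hik : i ≠ k)
    (hi : trackMeets r (s i)) (hk : trackMeets r (s k)) : CrossesInOrder r s := by
  refine h.crossesInOrder_left r hr fun l hl => ?_
  have hli : l = i := by
    by_contra hne
    exact h.pairwise_not_trackMeets_left hne (hl.trackMeets hi)
  have hlk : l = k := by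
    by_contra hne
    exact h.pairwise_not_trackMeets_left hne (hl.trackMeets hk)
  exact hik (hli.symm.trans hlk)

/-- **The printed square-grid property implies the H21 rendering.** A square grid `(s, t)` with
parameter `I` in the sense of Grimmett–Manolescu witnesses `HasSquareGridProperty` with the same
families and separation bound `M = I`: clauses 1–3 are (a) and `IsSquareGridGM.meets`,
betweenness (clause 4) follows from (b) via `crossesInOrder_of_trackMeets`, and clause 5 is (c).
(Grimmett–Manolescu 2014, §4.2; comparison with the H21 rendering of `IsoradialGraphs`.) [cite: GrimmettManolescu2014, §4.2] -/
theorem IsSquareGridGM.hasSquareGridProperty (h : emb.IsSquareGridGM s t I) :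
    emb.HasSquareGridProperty := by
  refine ⟨s, t, h.isSimpleTrack_left, h.isSimpleTrack_right, h.pairwise_not_trackMeets_left,
    h.pairwise_not_trackMeets_right, h.meets, ?_, ?_,
    ⟨I, fun i j => (h.encard_trackBetween_left_lt i j).le,
      fun i j => (h.encard_trackBetween_right_lt i j).le⟩⟩
  · intro i j k hij hjk r hr hi hk
    exact (h.crossesInOrder_of_trackMeets hr (show i ≠ k by omega) hi hk).trackMeets j
  · intro i j k hij hjk r hr hi hk
    exact (h.symm.crossesInOrder_of_trackMeets hr (show i ≠ k by omega) hi hk).trackMeets j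

/-- SGP(I) (printed) implies the H21 rendering `HasSquareGridProperty`.
(Grimmett–Manolescu 2014, §4.2.) [cite: GrimmettManolescu2014, §4.2] -/
theorem SquareGridPropertyGM.hasSquareGridProperty (h : emb.SquareGridPropertyGM I) :
    emb.HasSquareGridProperty := by
  obtain ⟨s, t, hst⟩ := h
  exact hst.hasSquareGridProperty

/-- The printed square-grid property implies the H21 rendering `HasSquareGridProperty` (the
converse fails, see the module docstring). (Grimmett–Manolescu 2014, §4.2.) [cite: GrimmettManolescu2014, §4.2] -/
theorem HasSquareGridPropertyGM.hasSquareGridProperty (h : emb.HasSquareGridPropertyGM) :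
    emb.HasSquareGridProperty := by
  obtain ⟨I, hI⟩ := h
  exact hI.hasSquareGridProperty

/-- SGP(I) implies SGP. (Grimmett–Manolescu 2014, §4.2.) [cite: GrimmettManolescu2014, §4.2] -/
theorem SquareGridPropertyGM.hasSquareGridPropertyGM (h : emb.SquareGridPropertyGM I) :
    emb.HasSquareGridPropertyGM :=
  ⟨I, h⟩

end

end RhombicEmbedding

/-! ### The square grid of `ℤ²` -/

/-- A train track of `ℤ²` that is not an antidiagonal track (up to reparametrisation) runs along
a diagonal, and therefore meets the antidiagonal track `i` exactly once, at an index depending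
monotonically on `i` (increasing for north-east, decreasing for south-west traversal).
(Grimmett–Manolescu 2014, §4.3.1: the track-system of an isoradial square lattice is a square
grid; via `isTrack_squareLattice_classification`.) [cite: GrimmettManolescu2014, §4.3.1] -/
theorem crossesInOrder_squareAntidiagTrack {r : ℤ → (zdGraph 2).edgeSet}
    (hr : squareLatticeEmbedding.IsTrack r)
    (hpar : ∀ i, ¬ IsReparametrization r (squareAntidiagTrack i)) :
    CrossesInOrder r squareAntidiagTrack := by
  obtain ⟨m₀, n₀, a, b, hab, hr'⟩ := isTrack_squareLattice_classification hr
  rcases hab with ⟨rfl, rfl⟩ | ⟨rfl, rfl⟩ | ⟨rfl, rfl⟩ | ⟨rfl, rfl⟩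
  · -- north-west along the antidiagonal `m₀`: a shift of `squareAntidiagTrack m₀`
    exact (hpar m₀ ⟨n₀, Or.inl fun n => by rw [hr']; congr 1 <;> ring⟩).elim
  · -- south-east along the antidiagonal `m₀`: a reversed shift
    exact (hpar m₀ ⟨n₀, Or.inr fun n => by rw [hr']; congr 1 <;> ring⟩).elim
  · -- north-east along a diagonal: meets the antidiagonal `i` exactly at index `i - m₀`
    refine ⟨fun i => i - m₀, Or.inl fun i j hij => show i - m₀ < j - m₀ by omega, fun i => ?_⟩
    ext m
    simp only [meetIndices, Set.mem_setOf_eq, Set.mem_singleton_iff]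
    constructor
    · rintro ⟨n, hn⟩
      rw [hr'] at hn
      have := squareAntidiagTrack_inj hn
      omega
    · rintro rfl
      exact ⟨n₀ + (i - m₀) * 1, by rw [hr']; congr 1; ring⟩
  · -- south-west along a diagonal: meets the antidiagonal `i` exactly at index `m₀ - i`
    refine ⟨fun i => m₀ - i, Or.inr fun i j hij => show m₀ - j < m₀ - i by omega, fun i => ?_⟩
    ext m
    simp only [meetIndices, Set.mem_setOf_eq, Set.mem_singleton_iff]
    constructor
    · rintro ⟨n, hn⟩
      rw [hr'] at hn
      have := squareAntidiagTrack_inj hn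
      omega
    · rintro rfl
      exact ⟨n₀ + (m₀ - i) * (-1), by rw [hr']; congr 1; ring⟩

/-- A train track of `ℤ²` that is not a diagonal track (up to reparametrisation) runs along an
antidiagonal, and therefore meets the diagonal track `j` exactly once, at an index depending
monotonically on `j`. (Grimmett–Manolescu 2014, §4.3.1; via
`isTrack_squareLattice_classification`.) [cite: GrimmettManolescu2014, §4.3.1] -/
theorem crossesInOrder_squareDiagTrack {r : ℤ → (zdGraph 2).edgeSet}
    (hr : squareLatticeEmbedding.IsTrack r)
    (hpar : ∀ j, ¬ IsReparametrization r (squareDiagTrack j)) :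
    CrossesInOrder r squareDiagTrack := by
  obtain ⟨m₀, n₀, a, b, hab, hr'⟩ := isTrack_squareLattice_classification hr
  rcases hab with ⟨rfl, rfl⟩ | ⟨rfl, rfl⟩ | ⟨rfl, rfl⟩ | ⟨rfl, rfl⟩
  · -- north-west along an antidiagonal: meets the diagonal `j` exactly at index `m₀ - n₀ - j`
    refine ⟨fun j => m₀ - n₀ - j, Or.inr fun i j hij => show m₀ - n₀ - j < m₀ - n₀ - i by omega,
      fun j => ?_⟩
    ext m
    simp only [meetIndices, Set.mem_setOf_eq, Set.mem_singleton_iff]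
    constructor
    · rintro ⟨n, hn⟩
      rw [hr', squareDiagTrack_eq] at hn
      have := squareAntidiagTrack_inj hn
      omega
    · rintro rfl
      exact ⟨n₀ + (m₀ - n₀ - j) * 1, by rw [hr', squareDiagTrack_eq]; congr 1; ring⟩
  · -- south-east along an antidiagonal: meets the diagonal `j` exactly at index `n₀ - m₀ + j`
    refine ⟨fun j => n₀ - m₀ + j, Or.inl fun i j hij => show n₀ - m₀ + i < n₀ - m₀ + j by omega,
      fun j => ?_⟩
    ext m
    simp only [meetIndices, Set.mem_setOf_eq, Set.mem_singleton_iff]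
    constructor
    · rintro ⟨n, hn⟩
      rw [hr', squareDiagTrack_eq] at hn
      have := squareAntidiagTrack_inj hn
      omega
    · rintro rfl
      exact ⟨n₀ + (n₀ - m₀ + j) * (-1), by rw [hr', squareDiagTrack_eq]; congr 1; ring⟩
  · -- north-east along the diagonal `m₀ - n₀`: a shift of `squareDiagTrack (m₀ - n₀)`
    exact (hpar (m₀ - n₀) ⟨n₀, Or.inl fun n => by rw [hr', squareDiagTrack_eq]; congr 1 <;> ring⟩).elim
  · -- south-west along the diagonal `m₀ - n₀`: a reversed shift
    exact (hpar (m₀ - n₀) ⟨n₀, Or.inr fun n => by rw [hr', squareDiagTrack_eq]; congr 1 <;> ring⟩).elim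

/-- No diagonal track of `ℤ²` is a reparametrisation of an antidiagonal track (the two families
are disjoint: compare the rhombi at indices `0` and `1`). (Grimmett–Manolescu 2014, §4.3.1.) [cite: GrimmettManolescu2014, §4.3.1] -/
theorem not_isReparametrization_squareDiagTrack_squareAntidiagTrack (i j : ℤ) :
    ¬ IsReparametrization (squareDiagTrack j) (squareAntidiagTrack i) := by
  rintro ⟨c, h | h⟩
  · have h0 := squareAntidiagTrack_inj ((squareDiagTrack_eq j 0).symm.trans (h 0))
    have h1 := squareAntidiagTrack_inj ((squareDiagTrack_eq j 1).symm.trans (h 1))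
    omega
  · have h0 := squareAntidiagTrack_inj ((squareDiagTrack_eq j 0).symm.trans (h 0))
    have h1 := squareAntidiagTrack_inj ((squareDiagTrack_eq j 1).symm.trans (h 1))
    omega

/-- **The antidiagonal and diagonal tracks of `ℤ²` form a square grid in the printed sense, with
`I = 1`**: both families consist of simple, pairwise non-meeting tracks
(`isSimpleTrack_squareAntidiagTrack_holds`, …), no diagonal is an antidiagonal, every other
track crosses each family exactly once per member and in order
(`crossesInOrder_squareAntidiagTrack`, `crossesInOrder_squareDiagTrack` — in fact there are no
other tracks, `S = ∅`), and consecutive crossings are at consecutive indices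
(`trackBetween_squareAntidiagTrack`, `trackBetween_squareDiagTrack`), so (c) holds with `I = 1`.
(Grimmett–Manolescu 2014, §4.3.1: "the track-system of [an isoradial square lattice] is simply a
square grid"; §1: the class `𝒢` includes `ℤ²`.) [cite: GrimmettManolescu2014, §4.3.1] -/
theorem isSquareGridGM_squareLattice :
    squareLatticeEmbedding.IsSquareGridGM squareAntidiagTrack squareDiagTrack 1 where
  isSimpleTrack_left := isSimpleTrack_squareAntidiagTrack_holds
  isSimpleTrack_right := isSimpleTrack_squareDiagTrack_holds
  pairwise_not_trackMeets_left _ _ hij := not_trackMeets_squareAntidiagTrack hij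
  pairwise_not_trackMeets_right _ _ hij := not_trackMeets_squareDiagTrack hij
  not_isReparametrization := not_isReparametrization_squareDiagTrack_squareAntidiagTrack
  crossesInOrder_left _ hr hpar := crossesInOrder_squareAntidiagTrack hr hpar
  crossesInOrder_right _ hr hpar := crossesInOrder_squareDiagTrack hr hpar
  encard_trackBetween_left_lt i j := by
    rw [trackBetween_squareAntidiagTrack, Set.encard_empty, Nat.cast_one]
    exact zero_lt_one
  encard_trackBetween_right_lt i j := by
    rw [trackBetween_squareDiagTrack, Set.encard_empty, Nat.cast_one]
    exact zero_lt_one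

/-- `ℤ²` satisfies SGP(1). (Grimmett–Manolescu 2014, §4.3.1.) [cite: GrimmettManolescu2014, §4.3.1] -/
theorem squareGridPropertyGM_squareLattice : squareLatticeEmbedding.SquareGridPropertyGM 1 :=
  ⟨_, _, isSquareGridGM_squareLattice⟩

/-- **`ℤ²` has the square-grid property in the printed sense of Grimmett–Manolescu.**
(Grimmett–Manolescu 2014, §1 and §4.3.1.) [cite: GrimmettManolescu2014, §4.3.1] -/
theorem hasSquareGridPropertyGM_squareLattice : squareLatticeEmbedding.HasSquareGridPropertyGM :=
  squareGridPropertyGM_squareLattice.hasSquareGridPropertyGM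

/-- **The track-system of `ℤ²` is exactly its square grid (`S = ∅`).** Every train track of the
isoradial square lattice is, up to reparametrisation, an antidiagonal track or a diagonal track
(the four cases of `isTrack_squareLattice_classification` are a shift or a reversed shift of
`squareAntidiagTrack m₀`, resp. of `squareDiagTrack (m₀ - n₀)`). (Grimmett–Manolescu 2014,
§4.3.1: "the track-system of [an isoradial square lattice] is simply a square grid"; §4.6.) [cite: GrimmettManolescu2014, §4.3.1] -/
theorem isReparametrization_of_isTrack_squareLattice {r : ℤ → (zdGraph 2).edgeSet}
    (hr : squareLatticeEmbedding.IsTrack r) :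
    (∃ i, IsReparametrization r (squareAntidiagTrack i)) ∨
      ∃ j, IsReparametrization r (squareDiagTrack j) := by
  obtain ⟨m₀, n₀, a, b, hab, hr'⟩ := isTrack_squareLattice_classification hr
  rcases hab with ⟨rfl, rfl⟩ | ⟨rfl, rfl⟩ | ⟨rfl, rfl⟩ | ⟨rfl, rfl⟩
  · exact Or.inl ⟨m₀, n₀, Or.inl fun n => by rw [hr']; congr 1 <;> ring⟩
  · exact Or.inl ⟨m₀, n₀, Or.inr fun n => by rw [hr']; congr 1 <;> ring⟩
  · exact Or.inr ⟨m₀ - n₀, n₀, Or.inl fun n => by rw [hr', squareDiagTrack_eq]; congr 1 <;> ring⟩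
  · exact Or.inr ⟨m₀ - n₀, n₀, Or.inr fun n => by rw [hr', squareDiagTrack_eq]; congr 1 <;> ring⟩

/-- In `ℤ²` the dichotomy of clause (b) is exhaustive in the strong sense: a train track that is
not an antidiagonal track is a diagonal track (up to reparametrisation), and vice versa.
(Grimmett–Manolescu 2014, §4.3.1.) [cite: GrimmettManolescu2014, §4.3.1] -/
theorem isReparametrization_squareDiagTrack_of_not_squareAntidiagTrack
    {r : ℤ → (zdGraph 2).edgeSet} (hr : squareLatticeEmbedding.IsTrack r)
    (hpar : ∀ i, ¬ IsReparametrization r (squareAntidiagTrack i)) :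
    ∃ j, IsReparametrization r (squareDiagTrack j) := by
  rcases isReparametrization_of_isTrack_squareLattice hr with ⟨i, hi⟩ | h
  · exact (hpar i hi).elim
  · exact h

end Literature.Probability.LatticeModels
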